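import Summits.ResolutionOfSingularities.ResolutionOfSingularities.Theorems.EquisingularLiftEquisingularLiftNatTowerCechRoundCloserLift
import Summits.ResolutionOfSingularities.ResolutionOfSingularities.Theorems.EquisingularLiftEquisingularLiftNatCechShadowOffSection
import Summits.ResolutionOfSingularities.ResolutionOfSingularities.Theorems.EquisingularLiftEquisingularLiftChainRegular
import HarnessLib

/-!
# [OURS · L1 W4.5(b) · EL♮(3)] (N3) `hShadow` IN THE DISJOINT CASE `Z ∩ closure K = ∅`: the transported shadow next to the new
# surface after a Čech round OFF the shadow — all five clauses, from res-L1-w45b-stub-2's (α)-bricks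

Crux chain w45b (cell `res-hironaka`, slot W4.5(b)), crux **EL♮(3)** = stmt-ResolutionOfSingularities-20148; rung TOWER₃/₄, stand-in S6
`hCech` = res-D-pv-057's `Tower.hCech_of_lift_sec` (p575157) modulo (L) / (N3) / (N3′) / S2. THIS FILE: the (N3) binder `hShadow` of
`Tower.hCech_of_lift_sec`, with its universally quantified objects as explicit binders IN THE SAME ORDER and its antecedents as named
hypotheses VERBATIM, under the ONE extra hypothesis `hZK : Disjoint Z (closure K)` (the DISJOINT CASE; the case «`Z` meets `closure K` in
points» is res-L1-w45b-stub-2 g8's), concluding the five (N3) clauses verbatim (res-L1-w45b-plan-1 NAMING 2026-08-27T21:52:01Z; hand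
res-rescue-typ-5 g3, custody DEAL #87). `--supports stmt-ResolutionOfSingularities-20148 --as helper`.
HONEST FRAMING: OURS; NOT a statement of any manuscript; AI-written, weaker than expert review. No `sorry`; standard axioms. DEF-FREE.

PROOF (the «degenerate Shadow₂ clauses»). With `𝒞 := 𝓔 ⊔ 𝒦₁` the Čech centre and `J := 𝓘⟨Z⟩` downstairs:
* `σ` is proper (`chain_isRegular`), so `σ ≫ q` is universally closed; the special fibre is `range jG` (`mem_range_of_model`); every special
  point of `supp 𝒞` comes from `Z` (`mem_of_comap_eq_vanishingIdeal`), no point of `Z` maps into `supp 𝒦` (`not_mem_support_of_trace_loc`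
  with `V = ⊤` and `hZK`) ⇒ **`supp 𝒦 ∩ supp 𝒞 = ∅`** (`disjoint_support_of_model_traces`).
* Hence `St_𝒞 𝒦 = 𝒦·𝒪_{X₂}` (res-L1-w45b-stub-4's `strictTransformIdeal_eq_comap_of_disjoint`, …NatBlowupDisjointTransport), and
  `𝒞·𝒪_{X₂} ⊔ St_𝒞 𝒦 = ⊤` (`comap_sup_comap_eq_top_of_disjoint`).
* (k-ii): `(𝒦·𝒪_{X₂})·𝒪_{G′} = 𝓘⟨closure υ₂⁻¹(K ∖ Z)⟩` (`comap_comap_eq_vanishingIdeal_of_disjoint_closure`); the flatness clause is about the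
  EMPTY subscheme `V(⊤)`; the regularity clause is vacuous (`supp ⊤ = ∅`); the two Cartier clauses are `IsEffectiveCartier ⊤`
  (`isEffectiveCartier_top`) since each restricted ideal has empty support.
-/

set_option linter.dupNamespace false -- mandated namespace `Summit.<Summit>.<Problem>` of this single-conjunct summit

noncomputable section

open CategoryTheory CategoryTheory.Limits AlgebraicGeometry TopologicalSpace Topology IsLocalRing
open Literature.AlgebraicGeometry.Resolution
open AlgebraicGeometry.Scheme.IdealSheafData
open Summit.ResolutionOfSingularities.ResolutionOfSingularities.Theses.EquisingularLift.Split
open Summit.ResolutionOfSingularities.ResolutionOfSingularities.Cruxes.EquisingularLift.StrataSplit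

namespace Summit.ResolutionOfSingularities.ResolutionOfSingularities.Cruxes.EquisingularLiftNat.Sections

/-! ## 1. Ideal sheaves with empty support -/

/-- An ideal sheaf whose support is empty is the unit ideal sheaf. [folklore] -/
theorem eq_top_of_support_eq_empty {X : Scheme.{0}} (I : X.IdealSheafData) (h : (I.support : Set X) = ∅) : I = ⊤ := by
  rw [← Scheme.IdealSheafData.support_eq_bot_iff]
  exact Closeds.ext h

/-- The restriction of `I` to the closed subscheme `V(J)` is the unit ideal when `supp I ∩ supp J = ∅`. [folklore] -/
theorem comap_subschemeι_eq_top_of_disjoint {X : Scheme.{0}} (I J : X.IdealSheafData)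
    (h : Disjoint (I.support : Set X) (J.support : Set X)) : I.comap J.subschemeι = ⊤ := by
  refine eq_top_of_support_eq_empty _ (Set.eq_empty_iff_forall_notMem.mpr fun y hy => ?_)
  rw [Scheme.IdealSheafData.support_comap, Closeds.coe_preimage] at hy
  have hyJ : (J.subschemeι y : X) ∈ (J.support : Set X) := by
    rw [← Scheme.IdealSheafData.range_subschemeι]; exact ⟨y, rfl⟩
  exact Set.disjoint_left.mp h hy hyJ

/-! ## 2. (N3) in the disjoint case -/

/-- **(N3) `hShadow` of `Tower.hCech_of_lift_sec`, DISJOINT CASE `Z ∩ closure K = ∅`.** The universally quantified objects of the (N3) binder as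
explicit arguments (same order), its antecedents verbatim as hypotheses, plus `hZK : Disjoint Z (closure K)`; conclusion = the five (N3) clauses
verbatim. Leading parameters `θ, hθ, q, hqprop, Y, hPnoeth, hPreg, hChain` are the closer's own. [OURS · L1 W4.5b] toward
`stub_elnat_coneTowerPointResolution` (stmt-ResolutionOfSingularities-20148); NOT a statement of the manuscript. -/
theorem Tower.hShadow_of_disjoint (O : Type) [CommRing O] [IsLocalRing O] (k : Type) [Field k]
    (θ : O →+* k) (hθ : Function.Surjective θ)
    (P : Scheme.{0}) (q : P ⟶ Spec (.of O)) (hqprop : IsProper q) (Y : Set P)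
    (hPnoeth : IsLocallyNoetherian P) (hPreg : Scheme.IsRegular P)
    (Ch : ∀ X' : Scheme.{0}, (X' ⟶ P) → Set X' → Prop)
    (hChain : ∀ (X' : Scheme.{0}) (σ : X' ⟶ P) (S : Set X'), Ch X' σ S → Chain P Y X' σ S)
    -- the (N3) objects, in the binder's order
    {F₉ : Scheme.{0}} (Z₉ : Set F₉) (hZ₉ : IsClosed Z₉) {F₁₀ : Scheme.{0}} (υ' : F₁₀ ⟶ F₉)
    (G G' : Scheme.{0}) (γ : G ⟶ F₁₀) (T E K : Set G) (hE : IsClosed E) (Z : Set G) (hZ : IsClosed Z) (υ₂ : G' ⟶ G)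
    (_hsec : DirStepSec F₉ F₁₀ υ' Z₉ hZ₉ G γ Z hZ) (hυ₂ : IsBlowup υ₂ (vanishingIdeal ⟨Z, hZ⟩))
    (X : Scheme.{0}) (σ : X ⟶ P) (S : Set X) (jG : G ⟶ X) (tG : G ⟶ Spec (.of k)) (𝓔 𝒦 𝒦₁ : X.IdealSheafData)
    (X₂ : Scheme.{0}) (τ : X₂ ⟶ X) (j₂ : G' ⟶ X₂) (t₂ : G' ⟶ Spec (.of k))
    (hCh : Ch X σ S) (_hXint : IsIntegral X) (hXnoeth : IsLocallyNoetherian X) (_hXreg : Scheme.IsRegular X) (_hdom : IsDominant (σ ≫ q))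
    (hsq : IsPullback jG tG (σ ≫ q) (Spec.map (CommRingCat.ofHom θ))) (_hTS : jG '' T = S)
    (_hEtr : 𝓔.comap jG = vanishingIdeal ⟨E, hE⟩) (_hEprin : ∀ z : X, (stalkIdeal 𝓔 z).IsPrincipal) (_hEreg : Scheme.IsRegular 𝓔.subscheme)
    (_hKprin : ∀ z : X, (stalkIdeal 𝒦 z).IsPrincipal) (hKtr : 𝒦.comap jG = vanishingIdeal (⟨closure K, isClosed_closure⟩ : Closeds G))
    (_hflatEK : Flat ((𝓔 ⊔ 𝒦).subschemeι ≫ σ ≫ q)) (_hcartEK : IsEffectiveCartier (𝓔.comap 𝒦.subschemeι))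
    (_hcartKE : IsEffectiveCartier (𝒦.comap 𝓔.subschemeι))
    (hCtr : (𝓔 ⊔ 𝒦₁).comap jG = vanishingIdeal ⟨Z, hZ⟩) (_hflatC : Flat ((𝓔 ⊔ 𝒦₁).subschemeι ≫ σ ≫ q))
    (_hCreg : Scheme.IsRegular (𝓔 ⊔ 𝒦₁).subscheme) (_hcart1 : IsEffectiveCartier (𝒦₁.comap 𝓔.subschemeι))
    (hτ : IsBlowup τ (𝓔 ⊔ 𝒦₁)) (_hsq₂ : IsPullback j₂ t₂ ((τ ≫ σ) ≫ q) (Spec.map (CommRingCat.ofHom θ))) (hcomm : j₂ ≫ τ = υ₂ ≫ jG)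
    (_hKcl : IsClosed K) (_hKE : K ⊆ closure (K \ E)) (_hKne : K ≠ Set.univ) (_hoff : closure (Z \ closure K) = Z)
    -- THE DISJOINT CASE
    (hZK : Disjoint Z (closure K)) :
    (strictTransformIdeal τ (𝓔 ⊔ 𝒦₁) 𝒦).comap j₂ =
        vanishingIdeal (⟨closure (closure (υ₂ ⁻¹' (K \ Z))), isClosed_closure⟩ : Closeds G') ∧
      Flat ((((𝓔 ⊔ 𝒦₁).comap τ) ⊔ strictTransformIdeal τ (𝓔 ⊔ 𝒦₁) 𝒦).subschemeι ≫ (τ ≫ σ) ≫ q) ∧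
      (∀ (hE' : IsClosed (υ₂ ⁻¹' Z)) (y : G'),
        j₂ y ∈ ((((𝓔 ⊔ 𝒦₁).comap τ) ⊔ strictTransformIdeal τ (𝓔 ⊔ 𝒦₁) 𝒦).support : Set X₂) →
        stalkIdeal (vanishingIdeal (⟨υ₂ ⁻¹' Z, hE'⟩ : Closeds G') ⊔
          vanishingIdeal (⟨closure (closure (υ₂ ⁻¹' (K \ Z))), isClosed_closure⟩ : Closeds G')) y =
        stalkIdeal (vanishingIdeal (⟨υ₂ ⁻¹' Z ∩ closure (closure (υ₂ ⁻¹' (K \ Z))), hE'.inter isClosed_closure⟩ : Closeds G')) y →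
        IsRegularLocalRing (X₂.presheaf.stalk (j₂ y) ⧸
          stalkIdeal (((𝓔 ⊔ 𝒦₁).comap τ) ⊔ strictTransformIdeal τ (𝓔 ⊔ 𝒦₁) 𝒦) (j₂ y))) ∧
      IsEffectiveCartier (((𝓔 ⊔ 𝒦₁).comap τ).comap (strictTransformIdeal τ (𝓔 ⊔ 𝒦₁) 𝒦).subschemeι) ∧
      IsEffectiveCartier ((strictTransformIdeal τ (𝓔 ⊔ 𝒦₁) 𝒦).comap ((𝓔 ⊔ 𝒦₁).comap τ).subschemeι) := by
  haveI := hqprop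
  haveI := hXnoeth
  -- `σ` proper ⇒ `σ ≫ q` universally closed; the special fibre is `range jG`
  obtain ⟨-, -, hσprop⟩ := chain_isRegular P Y X σ S (hChain X σ S hCh) hPnoeth hPreg
  haveI := hσprop
  haveI : UniversallyClosed (σ ≫ q) := inferInstance
  haveI : IsClosedImmersion (Spec.map (CommRingCat.ofHom θ)) := IsClosedImmersion.spec_of_surjective _ hθ
  haveI : IsClosedImmersion jG := MorphismProperty.IsStableUnderBaseChange.of_isPullback hsq.flip inferInstance
  haveI : IsLocallyNoetherian G := LocallyOfFiniteType.isLocallyNoetherian jG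
  haveI : IsProper τ := hτ.isProper
  haveI : IsLocallyNoetherian X₂ := LocallyOfFiniteType.isLocallyNoetherian τ
  have hZsupp : ((vanishingIdeal (⟨Z, hZ⟩ : Closeds G) : G.IdealSheafData).support : Set G) = Z :=
    Scheme.IdealSheafData.coe_support_vanishingIdeal _
  -- the centre misses the shadow
  have hdisj : Disjoint (𝒦.support : Set X) ((𝓔 ⊔ 𝒦₁).support : Set X) := by
    refine disjoint_support_of_model_traces (σ ≫ q) jG (fun x hx => mem_range_of_model θ hθ (σ ≫ q) jG tG hsq x hx)
      (𝓔 ⊔ 𝒦₁) 𝒦 Z (fun g hg => mem_of_comap_eq_vanishingIdeal jG (𝓔 ⊔ 𝒦₁) hZ hCtr g hg) ?_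
    refine not_mem_support_of_trace_loc jG 𝒦 K ⊤ (by rw [hKtr]) (fun _ _ => trivial) hZK
  have hKJ : Disjoint (closure K) (((vanishingIdeal (⟨Z, hZ⟩ : Closeds G) : G.IdealSheafData).support : Set G)) := by
    rw [hZsupp]; exact hZK.symm
  -- the strict transform of the shadow is its total transform; the two new ideals are comaximal
  have hSt : strictTransformIdeal τ (𝓔 ⊔ 𝒦₁) 𝒦 = 𝒦.comap τ := strictTransformIdeal_eq_comap_of_disjoint hτ 𝒦 hdisj
  have htop : ((𝓔 ⊔ 𝒦₁).comap τ) ⊔ strictTransformIdeal τ (𝓔 ⊔ 𝒦₁) 𝒦 = ⊤ := by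
    rw [hSt]; exact comap_sup_comap_eq_top_of_disjoint τ (𝓔 ⊔ 𝒦₁) 𝒦 hdisj
  have hdisj₂ : Disjoint (((𝓔 ⊔ 𝒦₁).comap τ).support : Set X₂) ((strictTransformIdeal τ (𝓔 ⊔ 𝒦₁) 𝒦).support : Set X₂) := by
    rw [hSt, Scheme.IdealSheafData.support_comap, Scheme.IdealSheafData.support_comap, Closeds.coe_preimage, Closeds.coe_preimage]
    exact hdisj.symm.preimage τ
  refine ⟨?_, ?_, ?_, ?_, ?_⟩
  · -- (k-ii) through the round
    rw [hSt, comap_comap_eq_vanishingIdeal_of_disjoint_closure hcomm hυ₂ 𝒦 K hKtr hKJ]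
    congr 1
    apply Closeds.ext
    change closure (υ₂ ⁻¹' (K \ _)) = closure (closure (υ₂ ⁻¹' (K \ Z)))
    rw [closure_closure, hZsupp]
  · -- flatness of the EMPTY subscheme
    have hflat : ∀ I : X₂.IdealSheafData, I = ⊤ → Flat (I.subschemeι ≫ (τ ≫ σ) ≫ q) := by
      rintro I rfl
      haveI : IsEmpty ((⊤ : X₂.IdealSheafData).subscheme) := by
        rw [← Set.range_eq_empty_iff (f := fun y => (⊤ : X₂.IdealSheafData).subschemeι y),
          show (Set.range fun y => (⊤ : X₂.IdealSheafData).subschemeι y) = Set.range (⊤ : X₂.IdealSheafData).subschemeι from rfl,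
          Scheme.IdealSheafData.range_subschemeι]
        simp
      infer_instance
    exact hflat _ htop
  · -- the regularity clause is vacuous
    intro hE' y hy
    rw [htop] at hy
    simp at hy
  · rw [comap_subschemeι_eq_top_of_disjoint _ _ hdisj₂]
    exact isEffectiveCartier_top
  · rw [comap_subschemeι_eq_top_of_disjoint _ _ hdisj₂.symm]
    exact isEffectiveCartier_top

/-! ## 3. (N3) in the disjoint case, `Inv₃` currency (the (k-ii-loc) form of `Tower.hCech₃_of_lift_sec`, p576661) -/

/-- **(N3) `hShadow` of `Tower.hCech₃_of_lift_sec` (the LOCALIZED (k-ii-loc) currency of res-D-pv-029's `Tower.Shadow₃` / v7), DISJOINT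
CASE `Z ∩ closure K = ∅`.** Same shape as `Tower.hShadow_of_disjoint`: the binder's objects as explicit arguments in order, its antecedents
verbatim (now with `V : G.Opens`, `E ⊆ V` and the trace equality RESTRICTED to `V`), plus `hZK : Disjoint Z (closure K)`; conclusion = the
five clauses verbatim, (k-ii) restricted to `υ₂⁻¹V` (`comap_comap_comap_ι_eq_of_disjoint_closure`; `Z ⊆ E ⊆ V` feeds
`not_mem_support_of_trace_loc`). [OURS · L1 W4.5b] toward `stub_elnat_coneTowerPointResolution` (stmt-ResolutionOfSingularities-20148);
NOT a statement of the manuscript. -/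
theorem Tower.hShadow₃_of_disjoint (O : Type) [CommRing O] [IsLocalRing O] (k : Type) [Field k]
    (θ : O →+* k) (hθ : Function.Surjective θ)
    (P : Scheme.{0}) (q : P ⟶ Spec (.of O)) (hqprop : IsProper q) (Y : Set P)
    (hPnoeth : IsLocallyNoetherian P) (hPreg : Scheme.IsRegular P)
    (Ch : ∀ X' : Scheme.{0}, (X' ⟶ P) → Set X' → Prop)
    (hChain : ∀ (X' : Scheme.{0}) (σ : X' ⟶ P) (S : Set X'), Ch X' σ S → Chain P Y X' σ S)
    -- the (N3) objects, in the binder's order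
    {F₉ : Scheme.{0}} (Z₉ : Set F₉) (hZ₉ : IsClosed Z₉) {F₁₀ : Scheme.{0}} (υ' : F₁₀ ⟶ F₉)
    (G G' : Scheme.{0}) (γ : G ⟶ F₁₀) (T E K : Set G) (hE : IsClosed E) (Z : Set G) (hZ : IsClosed Z) (υ₂ : G' ⟶ G)
    (_hsec : DirStepSec F₉ F₁₀ υ' Z₉ hZ₉ G γ Z hZ) (hυ₂ : IsBlowup υ₂ (vanishingIdeal ⟨Z, hZ⟩))
    (X : Scheme.{0}) (σ : X ⟶ P) (S : Set X) (jG : G ⟶ X) (tG : G ⟶ Spec (.of k)) (𝓔 𝒦 𝒦₁ : X.IdealSheafData)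
    (X₂ : Scheme.{0}) (τ : X₂ ⟶ X) (j₂ : G' ⟶ X₂) (t₂ : G' ⟶ Spec (.of k))
    (hCh : Ch X σ S) (_hXint : IsIntegral X) (hXnoeth : IsLocallyNoetherian X) (_hXreg : Scheme.IsRegular X) (_hdom : IsDominant (σ ≫ q))
    (hsq : IsPullback jG tG (σ ≫ q) (Spec.map (CommRingCat.ofHom θ))) (_hTS : jG '' T = S)
    (hEtr : 𝓔.comap jG = vanishingIdeal ⟨E, hE⟩) (_hEprin : ∀ z : X, (stalkIdeal 𝓔 z).IsPrincipal) (_hEreg : Scheme.IsRegular 𝓔.subscheme)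
    (_hKprin : ∀ z : X, (stalkIdeal 𝒦 z).IsPrincipal) (V : G.Opens) (hEV : E ⊆ (V : Set G))
    (hKtrV : (𝒦.comap jG).comap V.ι = (vanishingIdeal (⟨closure K, isClosed_closure⟩ : Closeds G)).comap V.ι)
    (_hflatEK : Flat ((𝓔 ⊔ 𝒦).subschemeι ≫ σ ≫ q)) (_hcartEK : IsEffectiveCartier (𝓔.comap 𝒦.subschemeι))
    (_hcartKE : IsEffectiveCartier (𝒦.comap 𝓔.subschemeι))
    (hCtr : (𝓔 ⊔ 𝒦₁).comap jG = vanishingIdeal ⟨Z, hZ⟩) (_hflatC : Flat ((𝓔 ⊔ 𝒦₁).subschemeι ≫ σ ≫ q))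
    (_hCreg : Scheme.IsRegular (𝓔 ⊔ 𝒦₁).subscheme) (_hcart1 : IsEffectiveCartier (𝒦₁.comap 𝓔.subschemeι))
    (hτ : IsBlowup τ (𝓔 ⊔ 𝒦₁)) (_hsq₂ : IsPullback j₂ t₂ ((τ ≫ σ) ≫ q) (Spec.map (CommRingCat.ofHom θ))) (hcomm : j₂ ≫ τ = υ₂ ≫ jG)
    (_hKcl : IsClosed K) (_hKE : K ⊆ closure (K \ E)) (_hKne : K ≠ Set.univ) (_hoff : closure (Z \ closure K) = Z)
    -- THE DISJOINT CASE
    (hZK : Disjoint Z (closure K)) :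
    ((strictTransformIdeal τ (𝓔 ⊔ 𝒦₁) 𝒦).comap j₂).comap (υ₂ ⁻¹ᵁ V).ι =
        (vanishingIdeal (⟨closure (closure (υ₂ ⁻¹' (K \ Z))), isClosed_closure⟩ : Closeds G')).comap (υ₂ ⁻¹ᵁ V).ι ∧
      Flat ((((𝓔 ⊔ 𝒦₁).comap τ) ⊔ strictTransformIdeal τ (𝓔 ⊔ 𝒦₁) 𝒦).subschemeι ≫ (τ ≫ σ) ≫ q) ∧
      (∀ (hE' : IsClosed (υ₂ ⁻¹' Z)) (y : G'),
        j₂ y ∈ ((((𝓔 ⊔ 𝒦₁).comap τ) ⊔ strictTransformIdeal τ (𝓔 ⊔ 𝒦₁) 𝒦).support : Set X₂) →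
        stalkIdeal (vanishingIdeal (⟨υ₂ ⁻¹' Z, hE'⟩ : Closeds G') ⊔
          vanishingIdeal (⟨closure (closure (υ₂ ⁻¹' (K \ Z))), isClosed_closure⟩ : Closeds G')) y =
        stalkIdeal (vanishingIdeal (⟨υ₂ ⁻¹' Z ∩ closure (closure (υ₂ ⁻¹' (K \ Z))), hE'.inter isClosed_closure⟩ : Closeds G')) y →
        IsRegularLocalRing (X₂.presheaf.stalk (j₂ y) ⧸
          stalkIdeal (((𝓔 ⊔ 𝒦₁).comap τ) ⊔ strictTransformIdeal τ (𝓔 ⊔ 𝒦₁) 𝒦) (j₂ y))) ∧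
      IsEffectiveCartier (((𝓔 ⊔ 𝒦₁).comap τ).comap (strictTransformIdeal τ (𝓔 ⊔ 𝒦₁) 𝒦).subschemeι) ∧
      IsEffectiveCartier ((strictTransformIdeal τ (𝓔 ⊔ 𝒦₁) 𝒦).comap ((𝓔 ⊔ 𝒦₁).comap τ).subschemeι) := by
  haveI := hqprop
  haveI := hXnoeth
  obtain ⟨-, -, hσprop⟩ := chain_isRegular P Y X σ S (hChain X σ S hCh) hPnoeth hPreg
  haveI := hσprop
  haveI : UniversallyClosed (σ ≫ q) := inferInstance
  haveI : IsClosedImmersion (Spec.map (CommRingCat.ofHom θ)) := IsClosedImmersion.spec_of_surjective _ hθ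
  haveI : IsClosedImmersion jG := MorphismProperty.IsStableUnderBaseChange.of_isPullback hsq.flip inferInstance
  haveI : IsLocallyNoetherian G := LocallyOfFiniteType.isLocallyNoetherian jG
  haveI : IsProper τ := hτ.isProper
  haveI : IsLocallyNoetherian X₂ := LocallyOfFiniteType.isLocallyNoetherian τ
  have hZsupp : ((vanishingIdeal (⟨Z, hZ⟩ : Closeds G) : G.IdealSheafData).support : Set G) = Z :=
    Scheme.IdealSheafData.coe_support_vanishingIdeal _
  -- `Z ⊆ E ⊆ V`
  have hZE : Z ⊆ E := by
    intro z hz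
    have h1 : z ∈ (((𝓔 ⊔ 𝒦₁).comap jG).support : Set G) := by
      rw [hCtr, Scheme.IdealSheafData.coe_support_vanishingIdeal]; exact hz
    have h2 : (((𝓔 ⊔ 𝒦₁).comap jG).support : Set G) ⊆ ((𝓔.comap jG).support : Set G) :=
      Scheme.IdealSheafData.support_antitone ((Scheme.IdealSheafData.comap_mono jG) le_sup_left)
    have h3 := h2 h1
    rw [hEtr, Scheme.IdealSheafData.coe_support_vanishingIdeal] at h3
    exact h3
  -- the centre misses the shadow
  have hdisj : Disjoint (𝒦.support : Set X) ((𝓔 ⊔ 𝒦₁).support : Set X) :=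
    disjoint_support_of_model_traces (σ ≫ q) jG (fun x hx => mem_range_of_model θ hθ (σ ≫ q) jG tG hsq x hx)
      (𝓔 ⊔ 𝒦₁) 𝒦 Z (fun g hg => mem_of_comap_eq_vanishingIdeal jG (𝓔 ⊔ 𝒦₁) hZ hCtr g hg)
      (not_mem_support_of_trace_loc jG 𝒦 K V hKtrV (hZE.trans hEV) hZK)
  have hKJ : Disjoint (closure K) (((vanishingIdeal (⟨Z, hZ⟩ : Closeds G) : G.IdealSheafData).support : Set G)) := by
    rw [hZsupp]; exact hZK.symm
  have hSt : strictTransformIdeal τ (𝓔 ⊔ 𝒦₁) 𝒦 = 𝒦.comap τ := strictTransformIdeal_eq_comap_of_disjoint hτ 𝒦 hdisj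
  have htop : ((𝓔 ⊔ 𝒦₁).comap τ) ⊔ strictTransformIdeal τ (𝓔 ⊔ 𝒦₁) 𝒦 = ⊤ := by
    rw [hSt]; exact comap_sup_comap_eq_top_of_disjoint τ (𝓔 ⊔ 𝒦₁) 𝒦 hdisj
  have hdisj₂ : Disjoint (((𝓔 ⊔ 𝒦₁).comap τ).support : Set X₂) ((strictTransformIdeal τ (𝓔 ⊔ 𝒦₁) 𝒦).support : Set X₂) := by
    rw [hSt, Scheme.IdealSheafData.support_comap, Scheme.IdealSheafData.support_comap, Closeds.coe_preimage, Closeds.coe_preimage]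
    exact hdisj.symm.preimage τ
  refine ⟨?_, ?_, ?_, ?_, ?_⟩
  · -- (k-ii-loc) through the round
    rw [hSt, comap_comap_comap_ι_eq_of_disjoint_closure hcomm hυ₂ 𝒦 K V hKtrV hKJ]
    congr 2
    apply Closeds.ext
    change closure (υ₂ ⁻¹' (K \ _)) = closure (closure (υ₂ ⁻¹' (K \ Z)))
    rw [closure_closure, hZsupp]
  · have hflat : ∀ I : X₂.IdealSheafData, I = ⊤ → Flat (I.subschemeι ≫ (τ ≫ σ) ≫ q) := by
      rintro I rfl
      haveI : IsEmpty ((⊤ : X₂.IdealSheafData).subscheme) := by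
        rw [← Set.range_eq_empty_iff (f := fun y => (⊤ : X₂.IdealSheafData).subschemeι y),
          show (Set.range fun y => (⊤ : X₂.IdealSheafData).subschemeι y) = Set.range (⊤ : X₂.IdealSheafData).subschemeι from rfl,
          Scheme.IdealSheafData.range_subschemeι]
        simp
      infer_instance
    exact hflat _ htop
  · intro hE' y hy
    rw [htop] at hy
    simp at hy
  · rw [comap_subschemeι_eq_top_of_disjoint _ _ hdisj₂]
    exact isEffectiveCartier_top
  · rw [comap_subschemeι_eq_top_of_disjoint _ _ hdisj₂.symm]
    exact isEffectiveCartier_top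

end Summit.ResolutionOfSingularities.ResolutionOfSingularities.Cruxes.EquisingularLiftNat.Sections

end
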